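import Summits.ValiantsHypothesis.ValiantsHypothesis.Theses.LacunarySymmetroid
import Summits.ValiantsHypothesis.ValiantsHypothesis.Theorems.LacunarySymmetroidMatrixDescartesCensusDefs
import Summits.ValiantsHypothesis.ValiantsHypothesis.Theorems.LacunarySymmetroidMatrixDescartesCensusFrame
import Summits.ValiantsHypothesis.ValiantsHypothesis.Theorems.LacunarySymmetroidMatrixDescartesStubNegRoots
import Summits.ValiantsHypothesis.ValiantsHypothesis.Theorems.MatrixDescartes.Negative.MatrixDescartesWitness24

/-!
# `MatrixDescartes` — census currencies agree exactly: `M(m,K) = 2 ζ(m,K) + 1`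

HONEST FRAMING.  Object-search cell `pub-symmetroid`, crux `Theses.LacunarySymmetroid.MatrixDescartes`
(stmt-ValiantsHypothesis-18050).  Nothing here bounds the crux; no `VP ≠ VNP` claim.  The cell tabulates
`ζ(m,K)` = max number of distinct POSITIVE zeros (rows `PosRootLawAt m K B`), while the crux counts ALL distinct
real zeros (rows `RealRootLawAt m K B`, max `M(m,K)`).  The lead's convention R1 "`ζ_tot = 2ζ + 1` (`t ↦ t²`, `·t`)"
is made a kernel fact: for every format,
`PosRootLawAt m K B ↔ RealRootLawAt m K (2B + 1)` (`posRootLawAt_iff_realRootLawAt`), i.e. `M(m,K) = 2ζ(m,K) + 1`.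
(`→`) reflection `X ↦ −X` keeps symmetry and `0` counts once (tree `stub_negRoots`); (`←`) the ODD DOUBLING
`(d, S) ↦ (2d + 1, S)`: `det (∑ X^(2dₗ+1) Sₗ) = X^m · (det ∑ X^(dₗ) Sₗ)(X²)` (`det_pencil_oddDouble`), whose distinct
real zeros are `0` and `±√r` over the positive zeros `r` of the original determinant, so `Z = 2 Z₊ + 1` whenever
`m ≥ 1` and the determinant is not identically zero (`two_mul_card_posRoots_add_one_le` gives `≥`). [folklore]
-/

-- `Summit.ValiantsHypothesis.ValiantsHypothesis.…` repeats a component by the D-0017 layout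
-- (single-conjunct summit), which the `dupNamespace` linter flags; the name is mandated.
set_option linter.dupNamespace false

namespace Summit.ValiantsHypothesis.ValiantsHypothesis.Theorems.LacunarySymmetroidMatrixDescartes.Census

open Summit.ValiantsHypothesis.ValiantsHypothesis.Theorems.MatrixDescartes.Negative (PosRootLawAt)
open scoped BigOperators Matrix
open Polynomial

/-- **Odd doubling of a lacunary pencil**: replacing every exponent `dₗ` by `2dₗ + 1` multiplies the determinant
by `X^m` and substitutes `X²`: `det (∑ X^(2dₗ+1) • Sₗ) = X^m · (det (∑ X^(dₗ) • Sₗ)).comp (X²)`. [folklore] -/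
theorem det_pencil_oddDouble {m K : ℕ} (d : Fin K → ℕ) (S : Fin K → Matrix (Fin m) (Fin m) ℝ) :
    Matrix.det (∑ l, ((Polynomial.X : Polynomial ℝ) ^ (2 * d l + 1)) • (S l).map Polynomial.C)
      = (Polynomial.X : Polynomial ℝ) ^ m *
        (Matrix.det (∑ l, ((Polynomial.X : Polynomial ℝ) ^ d l) • (S l).map Polynomial.C)).comp
          ((Polynomial.X : Polynomial ℝ) ^ 2) := by
  have h : (∑ l, ((X : ℝ[X]) ^ (2 * d l + 1)) • (S l).map C)
      = (X : ℝ[X]) • (Polynomial.compRingHom ((X : ℝ[X]) ^ 2)).mapMatrix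
          ((∑ l, ((X : ℝ[X]) ^ d l) • (S l).map C : Matrix (Fin m) (Fin m) ℝ[X])) := by
    refine Matrix.ext fun i j => ?_
    simp only [Matrix.sum_apply, Matrix.smul_apply, Matrix.map_apply, smul_eq_mul,
      RingHom.mapMatrix_apply, map_sum, map_mul, map_pow, Polynomial.coe_compRingHom_apply,
      Polynomial.X_comp, Polynomial.C_comp, Finset.mul_sum]
    refine Finset.sum_congr rfl fun l _ => ?_
    ring
  rw [h, Matrix.det_smul, Fintype.card_fin, ← RingHom.map_det, Polynomial.coe_compRingHom_apply]

/-- For `m ≥ 1` and a nonzero real polynomial `p`, the polynomial `X^m · p(X²)` has at least `2 Z₊(p) + 1`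
distinct real zeros: `0` and `±√r` for every positive zero `r` of `p`. [folklore] -/
theorem two_mul_card_posRoots_add_one_le {m : ℕ} (hm : 0 < m) (p : ℝ[X]) (hp : p ≠ 0) :
    2 * (p.roots.toFinset.filter (fun t => 0 < t)).card + 1 ≤
      (((Polynomial.X : Polynomial ℝ) ^ m * p.comp ((Polynomial.X : Polynomial ℝ) ^ 2)
        ).roots.toFinset).card := by
  classical
  set P := p.roots.toFinset.filter (fun t => 0 < t) with hP
  set q : ℝ[X] := X ^ m * p.comp (X ^ 2) with hq
  have hX2 : (X : ℝ[X]) ^ 2 ≠ C (((X : ℝ[X]) ^ 2).coeff 0) := by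
    intro h
    have h' := congrArg Polynomial.natDegree h
    simp at h'
  have hpc : p.comp (X ^ 2) ≠ 0 := by
    intro h
    rcases Polynomial.comp_eq_zero_iff.1 h with h0 | ⟨_, h2⟩
    · exact hp h0
    · exact hX2 h2
  have hq0 : q ≠ 0 := mul_ne_zero (pow_ne_zero _ X_ne_zero) hpc
  have rootq : ∀ t : ℝ, (t = 0 ∨ p.IsRoot (t ^ 2)) → t ∈ q.roots.toFinset := by
    intro t ht
    rw [Multiset.mem_toFinset, mem_roots hq0, IsRoot.def, hq, eval_mul, eval_pow, eval_X, eval_comp,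
      eval_pow, eval_X]
    rcases ht with rfl | h
    · simp [hm.ne']
    · rw [IsRoot.def] at h
      rw [h, mul_zero]
  have memP : ∀ r ∈ P, 0 < r ∧ p.IsRoot r := fun r hr => by
    have h := Finset.mem_filter.1 hr
    exact ⟨h.2, (mem_roots hp).1 (Multiset.mem_toFinset.1 h.1)⟩
  set A := P.image Real.sqrt with hA
  set B := P.image (fun r => -Real.sqrt r) with hB
  have hAc : A.card = P.card :=
    Finset.card_image_of_injOn fun r hr s hs h =>
      (Real.sqrt_inj (memP r hr).1.le (memP s hs).1.le).1 h
  have hBc : B.card = P.card :=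
    Finset.card_image_of_injOn fun r hr s hs h =>
      (Real.sqrt_inj (memP r hr).1.le (memP s hs).1.le).1 (neg_inj.1 h)
  have hAB : Disjoint A B := by
    rw [Finset.disjoint_left]
    intro t htA htB
    obtain ⟨r, hr, rfl⟩ := Finset.mem_image.1 htA
    obtain ⟨s, hs, hst⟩ := Finset.mem_image.1 htB
    have h1 : 0 < Real.sqrt r := Real.sqrt_pos.2 (memP r hr).1
    have h2 : 0 ≤ Real.sqrt s := Real.sqrt_nonneg s
    linarith
  have h0 : (0 : ℝ) ∉ A ∪ B := by
    intro h
    rcases Finset.mem_union.1 h with h | h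
    · obtain ⟨r, hr, hr0⟩ := Finset.mem_image.1 h
      have := Real.sqrt_pos.2 (memP r hr).1
      linarith
    · obtain ⟨r, hr, hr0⟩ := Finset.mem_image.1 h
      have := Real.sqrt_pos.2 (memP r hr).1
      linarith
  have hcard : (insert (0 : ℝ) (A ∪ B)).card = 2 * P.card + 1 := by
    rw [Finset.card_insert_of_notMem h0, Finset.card_union_of_disjoint hAB, hAc, hBc]
    ring
  have hsub : insert (0 : ℝ) (A ∪ B) ⊆ q.roots.toFinset := by
    intro t ht
    rcases Finset.mem_insert.1 ht with rfl | ht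
    · exact rootq 0 (Or.inl rfl)
    · rcases Finset.mem_union.1 ht with ht | ht
      · obtain ⟨r, hr, rfl⟩ := Finset.mem_image.1 ht
        refine rootq _ (Or.inr ?_)
        rw [Real.sq_sqrt (memP r hr).1.le]
        exact (memP r hr).2
      · obtain ⟨r, hr, rfl⟩ := Finset.mem_image.1 ht
        refine rootq _ (Or.inr ?_)
        rw [neg_sq, Real.sq_sqrt (memP r hr).1.le]
        exact (memP r hr).2
  calc 2 * P.card + 1 = (insert (0 : ℝ) (A ∪ B)).card := hcard.symm
    _ ≤ q.roots.toFinset.card := Finset.card_le_card hsub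

/-- **The two census currencies agree: `M(m,K) = 2ζ(m,K) + 1`.**  For every format and bound,
`PosRootLawAt m K B ↔ RealRootLawAt m K (2B + 1)`: (`→`) reflection; (`←`) apply the all-real row to the odd
doubling `(2d + 1, S)` of a given pencil `(d, S)`, whose determinant `X^m · (det F)(X²)` has `2 Z₊ + 1` distinct
real zeros.  (`m = 0`: the empty determinant is `1`, both rows hold.)  [folklore] -/
theorem posRootLawAt_iff_realRootLawAt (m K B : ℕ) :
    PosRootLawAt m K B ↔ RealRootLawAt m K (2 * B + 1) := by
  refine ⟨realRootLawAt_of_posRootLawAt, fun h d S hS => ?_⟩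
  rcases Nat.eq_zero_or_pos m with rfl | hm
  · have h1 : Matrix.det (∑ l, ((X : ℝ[X]) ^ d l) • (S l).map Polynomial.C) = 1 :=
      Matrix.det_isEmpty
    rw [h1, Polynomial.roots_one]
    simp
  · by_cases hp : Matrix.det (∑ l, ((X : ℝ[X]) ^ d l) • (S l).map Polynomial.C) = 0
    · rw [hp, Polynomial.roots_zero]
      simp
    · have h1 := h (fun l => 2 * d l + 1) S hS
      rw [det_pencil_oddDouble] at h1
      have h2 := two_mul_card_posRoots_add_one_le hm _ hp
      omega

/-- The even bounds too: a symmetric witness with `Z₊ > B` yields, by odd doubling, one with `Z > 2B + 2`;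
so `¬ PosRootLawAt m K B → ¬ RealRootLawAt m K (2B + 2)` (for `m ≥ 1`; at `m = 0` every row holds).  Together
with `posRootLawAt_iff_realRootLawAt`: `M(m,K) = 2ζ(m,K) + 1` EXACTLY — the all-real row fails at `2ζ` and holds
at `2ζ + 1`. [folklore] -/
theorem not_realRootLawAt_of_not_posRootLawAt {m K B : ℕ} (hm : 0 < m) (h : ¬ PosRootLawAt m K B) :
    ¬ RealRootLawAt m K (2 * B + 2) := by
  intro hR
  apply h
  intro d S hS
  by_contra hlt
  rw [not_le] at hlt
  by_cases hp : Matrix.det (∑ l, ((X : ℝ[X]) ^ d l) • (S l).map Polynomial.C) = 0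
  · rw [hp, Polynomial.roots_zero] at hlt
    simp at hlt
  · have h1 := hR (fun l => 2 * d l + 1) S hS
    rw [det_pencil_oddDouble] at h1
    have h2 := two_mul_card_posRoots_add_one_le hm _ hp
    omega

/-- Hence the crux in the cell's own currency: `MatrixDescartes` holds iff for all `c` and `q > 0`,
eventually in `K` and uniformly for `m ≤ 2^((⌊log₂K⌋+c)^c)`, some `B` with `(2B+1)^q ≤ 2^(K⌊log₂K⌋)` has
`ζ(m,K) ≤ B` (`PosRootLawAt m K B`).  [folklore] -/
theorem matrixDescartes_iff_posRootLaw :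
    Summit.ValiantsHypothesis.ValiantsHypothesis.Theses.LacunarySymmetroid.MatrixDescartes ↔
    ∀ c q : ℕ, 0 < q → ∃ K₀ : ℕ, ∀ K m : ℕ, K₀ ≤ K → m ≤ 2 ^ ((Nat.log 2 K + c) ^ c) →
      ∃ B : ℕ, PosRootLawAt m K B ∧ (2 * B + 1) ^ q ≤ 2 ^ (K * Nat.log 2 K) := by
  classical
  constructor
  · intro h c q hq
    obtain ⟨K₀, hK⟩ := h c q hq
    refine ⟨K₀, fun K m hKK hm => ?_⟩
    have hP0 : (fun n : ℕ => (2 * n + 1) ^ q ≤ 2 ^ (K * Nat.log 2 K)) 0 := by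
      show (2 * 0 + 1) ^ q ≤ 2 ^ (K * Nat.log 2 K)
      rw [mul_zero, zero_add, one_pow]
      exact Nat.one_le_two_pow
    refine ⟨Nat.findGreatest (fun n : ℕ => (2 * n + 1) ^ q ≤ 2 ^ (K * Nat.log 2 K)) (2 ^ (K * Nat.log 2 K)),
      fun d S hS => ?_,
      Nat.findGreatest_spec (P := fun n : ℕ => (2 * n + 1) ^ q ≤ 2 ^ (K * Nat.log 2 K)) (Nat.zero_le _) hP0⟩
    -- `n := Z₊(d, S)` satisfies the predicate, by the crux applied to the odd doubling of `(d, S)`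
    have hPn : (fun n : ℕ => (2 * n + 1) ^ q ≤ 2 ^ (K * Nat.log 2 K))
        (((∑ l, (X : ℝ[X]) ^ d l • (S l).map Polynomial.C).det.roots.toFinset.filter
          (fun t => 0 < t)).card) := by
      show (2 * ((∑ l, (X : ℝ[X]) ^ d l • (S l).map Polynomial.C).det.roots.toFinset.filter
          (fun t => 0 < t)).card + 1) ^ q ≤ 2 ^ (K * Nat.log 2 K)
      rcases Nat.eq_zero_or_pos m with rfl | hmpos
      · have h1 : Matrix.det (∑ l, ((X : ℝ[X]) ^ d l) • (S l).map Polynomial.C) = 1 :=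
          Matrix.det_isEmpty
        rw [h1, Polynomial.roots_one, Multiset.empty_eq_zero, Multiset.toFinset_zero, Finset.filter_empty,
          Finset.card_empty, mul_zero, zero_add, one_pow]
        exact Nat.one_le_two_pow
      · by_cases hp : Matrix.det (∑ l, ((X : ℝ[X]) ^ d l) • (S l).map Polynomial.C) = 0
        · rw [hp, Polynomial.roots_zero, Multiset.toFinset_zero, Finset.filter_empty, Finset.card_empty,
            mul_zero, zero_add, one_pow]
          exact Nat.one_le_two_pow
        · have h1 := hK K m hKK hm (fun l => 2 * d l + 1) S hS
          rw [det_pencil_oddDouble] at h1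
          have h2 := two_mul_card_posRoots_add_one_le hmpos _ hp
          exact (Nat.pow_le_pow_left h2 q).trans h1
    have hn : ((∑ l, (X : ℝ[X]) ^ d l • (S l).map Polynomial.C).det.roots.toFinset.filter
          (fun t => 0 < t)).card ≤ 2 ^ (K * Nat.log 2 K) :=
      calc ((∑ l, (X : ℝ[X]) ^ d l • (S l).map Polynomial.C).det.roots.toFinset.filter
              (fun t => 0 < t)).card
          ≤ 2 * ((∑ l, (X : ℝ[X]) ^ d l • (S l).map Polynomial.C).det.roots.toFinset.filter
              (fun t => 0 < t)).card + 1 := by omega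
        _ ≤ (2 * ((∑ l, (X : ℝ[X]) ^ d l • (S l).map Polynomial.C).det.roots.toFinset.filter
              (fun t => 0 < t)).card + 1) ^ q := Nat.le_self_pow hq.ne' _
        _ ≤ 2 ^ (K * Nat.log 2 K) := hPn
    exact Nat.le_findGreatest hn hPn
  · intro h c q hq
    obtain ⟨K₀, hK⟩ := h c q hq
    refine ⟨K₀, fun K m hKK hm d S hS => ?_⟩
    obtain ⟨B, hB, hBq⟩ := hK K m hKK hm
    have hZ := (posRootLawAt_iff_realRootLawAt m K B).1 hB d S hS
    exact (Nat.pow_le_pow_left hZ q).trans hBq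

end Summit.ValiantsHypothesis.ValiantsHypothesis.Theorems.LacunarySymmetroidMatrixDescartes.Census
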